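import Mathlib
import HarnessLib
import Summits.CriticalPhenomena.SAWScalingLimit.Theses.SAWDevelopingMap
import Literature.Barriers.CriticalPhenomena.ParafermionicHalfCauchyRiemann

/-!
# Birth skeleton (BC3) — crux `QCIdentification` (stmt-CriticalPhenomena-8298), route SAWDevelopingMap

Crux (FIXED, by name): `Summit.CriticalPhenomena.SAWScalingLimit.Theses.SAWDevelopingMap.QCIdentification`
`:= NoFoldBound → InteriorFlattening → HexObservableLimit` — the compactness-and-identification step of
the developing-map line: the no-fold bound (K) and bulk flattening (M) of the Duminil-Copin–Smirnov
parafermionic observable `F = F(a, ·, x_c, 5/8)` imply DCS 2012 Conjecture 2 in its typed, `ψ`-averaged,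
`F(b_δ)`-normalised form `HexObservableLimit` (flat, rigid-rowed at both marked points).

## The cut (five registered stubs; `QCIdentification_of` composes them with a REAL proof)

Write `A_δ(ψ) := δ² Σ_{e ∈ Ω_δ} ψ(δ·m_e) F_δ(e)` (`bulkAverage`) and `I(ψ) := ∫ ψ · e^{(5/8)(L − L_b)}`
(`shapeIntegral`; `e^{(5/8)(L − L_b)} = (φ′/φ′(b))^{5/8}` in the branch the target fixes). The target says
`A_δ(ψ) / F_δ(b_δ) → c · I(ψ)` with ONE universal `c ≠ 0`. It is cut along the two genuinely different
objects it compares — the SHAPE of the bulk field and the AMPLITUDE of one boundary value: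

* `stub_noBranching : NoFoldBound → NoBranching` — under (K) the PL developing map `H_δ` (`F = dH`,
  `PotentialExists`, proved) has no branch point at any interior hexagon centre: the six argument
  increments of the `∂H`-mode `S(v) = F(p₀)+F(p₁)+F(p₂)` around a hexagon sum to `0`, not `2πk`
  (PL Gauss–Bonnet on the face disc + the exact turning budget `(3/8)·2π + 2·(5π/8) = 2π` of the image
  polygon). Finite combinatorics/topology, M-sized, provable now (triage r1: "the natural FIRST stub of
  any line here"; fans `= 0` in 172 + 230 enumerated hexagon instances). It is the local-injectivity
  input of the compactness stub.
* `stub_subsequentialLimits : NoBranching → NoFoldBound → InteriorFlattening → SubsequentialLimits` —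
  QC COMPACTNESS + HOLOMORPHY with a MACROSCOPIC normalisation: for admissible data and every sequence
  `δ_n → 0⁺` there are a subsequence, normalisers `ν_n ∈ ℂ` and a holomorphic, not identically zero
  `g` on `Ω` with `ν_n A_{δ_n}(ψ) → ∫ ψ g` for every test function `ψ`. Mechanism: (K) + no branching
  ⇒ the normalised `H_δ` are a normal family of `K`-quasiregular local homeomorphisms with
  non-constant limits (Lehto–Virtanen II.5, AIM Thm 3.9.4 / local boundedness à la Miniowitz, Stoilow);
  (M) ⇒ `μ_δ → 0` on compacts ⇒ limits conformal (good approximation, AIM Lemma 5.3.5); `g = ∂h`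
  through `Σ_e ψ F = ½ Σ_v ψ(v) S(v) + O(δ‖∇ψ‖Σ|F|)`, `S = 6i√3 ∂H`. Size L/XL.
* `stub_boundaryRigidity : NoBranching → NoFoldBound → InteriorFlattening → BoundaryRigidity` —
  IDENTIFICATION:
  every continuous, not identically zero, subsequential projective limit density `g` of the bulk
  averages equals `c · e^{(5/8)(L − L_b)}` on `Ω`. Mechanism: the exact boundary winding gives the image
  polygon `Π_δ = H_δ(∂)` the edge-direction law `(3/8)θ_ν(p) + (5/8)θ_ν(a) + 5π/8`; on zigzag sides the
  image sides are EXACTLY straight (Schwarz reflection), `u = arg h′ − (5/8) arg φ′` is bounded harmonic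
  with one constant boundary value off {corners, a} ⇒ `h′ = c (φ′)^{5/8}` with no length data
  (Lindelöf / Ransford Thm 3.6.9); general Jordan `Ω`: per-slope boundary-layer twist `t ≡ 0`
  (Kennedy–Lawler factors; kink law `3√3/(16 sin(π/8))` verified to 1 % by transfer matrix) or interior
  approximation. THE HARDEST STUB (XL; the crux's recorded why-it-might-fail lives here).
* `stub_lateralUniversality : ZigzagLateralUniversality` — the lattice input (N1) both triagers isolate
  as the right residual for the `F(b_δ)`-normaliser (qc compactness cannot see one lattice derivative;
  rate-free one-step ratio limits are too weak): on an exact flat zigzag window of radius `M`, boundary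
  values at row distance `≤ ηM` agree to relative error `ε`, uniformly (Kennedy–Lawler locality /
  boundary Harnack for the SAW generating function). Size L, open lattice statement; survives the
  disconnected-`Λ` junk model (`0 ≤ ε·0`).
* `stub_boundaryAmplitude : NoBranching → NoFoldBound → InteriorFlattening → ZigzagLateralUniversality →
  BoundaryAmplitude` — THE NORMALISER: there is ONE universal `κ ≠ 0` such that whenever normalisers `ν_n` make the bulk
  averages converge to `I(ψ)` along `δ_n → 0⁺`, the same `ν_n` make `F_{δ_n}(b_{δ_n}) → κ`. Mechanism:
  the flat rigid row at `b` maps to an exactly straight image segment, `R ∘ H_δ ∘ R_b` is `K`-quasiregular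
  on the doubled window so `b` becomes interior; (M) ⇒ conformal limit across the row; window sums
  `Σ_{p ∈ I} F(p) = 2√3 i (H(Q) − H(P))` are identified from the bulk; (N1) turns window sums into the
  point value; `κ = ℓ_zz / (mid-edge density)`. Size L.

`QCIdentification_of` is NOT a one-line seam: `projectiveShape_of` turns compactness + rigidity into
projective convergence along subsequences with the RIGHT limit (integral congruence off `tsupport ψ`,
renormalisation by `c⁻¹`, `c ≠ 0` from non-degeneracy), and `hexObservableLimit_of` turns shape +
amplitude into the target along the full filter `𝓝[>] 0` (sub-subsequence principle
`Filter.tendsto_of_subseq_tendsto`, eventual non-vanishing of the normaliser, `(νA)/(νF(b)) = A/F(b)`,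
`c = κ⁻¹`). No `sorry` outside `stub_*`.

## Disproof used
`Disproof.lean` of refuter-cdisprove-stmt-CriticalPhenomena-8298-0 (cycle 1, rc 0, 0 sorry; mounted on
this hub only as item evidence notes): §1 sandwich `HexObservableLimit → QCIdentification`,
`¬QCIdentification ↔ NoFoldBound ∧ InteriorFlattening ∧ ¬HexObservableLimit`; §2 every Without-variant is
implied by the target, so NO `_false_without_<H>` obstruction exists short of `¬` Conj. 2 — nothing to
honour stub-wise; §3 tightness `k ≥ β_T/α_T = 0.614` of (K) (`noFoldBoundWith_const_ge`) — respected: no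
stub fixes a value of `k`. No landed `Theorems/QCIdentification/Negative/*` exists (checked
2026-08-17). Negatives index (`ledger negatives`): 0772 (all-δ tightness), 5420 (root corridor — the
target here is the repaired 14003, pinned at `a` AND `b`), 8312, 8261 — none is restated by a stub.
Typed-signature hygiene from triage r1 (S1, disconnected `Λ`): `NoBranching` is guarded by
`modeSum ≠ 0`, (N1) is homogeneous (`0 ≤ ε·0`), and every continuum stub carries the target's own
`(hexGraph.induce Λ_δ).Preconnected` clause inside `Admissible`.

## Necessity (why this is a cut and not a costume)
Each continuum stub's CONCLUSION is implied by the target for the same data: given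
`HexObservableLimit`, `SubsequentialLimits` holds with `φ = id`, `ν_n = 1/F(b_{δ_n})`, `g = c·e^{(5/8)(L−L_b)}`;
`BoundaryRigidity` holds because `ν_n F(b_{δ_n})` is forced to converge (test against one `ψ` with
`I(ψ) ≠ 0`), so `g = r c e^{(5/8)(L−L_b)}` as distributions, hence pointwise by continuity;
`BoundaryAmplitude` holds with `κ = c⁻¹`. So `HexObservableLimit ⟺ ProjectiveShape ∧ BoundaryAmplitude`
(modulo the proved glue), and no stub is the crux reworded: stubs 2–3 never mention `F(b_δ)`, stub 5 never
identifies a shape, stubs 1 and 4 are lattice statements with no limit object.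

## BC3 log (2026-08-17, planner-skel-stmt-CriticalPhenomena-8298-0)
`lean check --json` on this file: rc 0, errors [], sorries 5 = the five `stub_*` (warning lines only at
the stub declarations), axioms of `hexObservableLimit_of` / `QCIdentification_of`: propext,
Classical.choice, Quot.sound. Probes (folder `bc/stub_<name>_probe2.lean`, one example per tactic, each
under `set_option maxHeartbeats 400000`): for every stub signature `T` and both targets
`QCIdentification` and `_root_.SAWScalingLimit`, `by exact?` → "could not close the goal", `by simpa`
→ "assumption failed", `by aesop` → "failed to prove the goal after exhaustive search", `by simpa [<defs>]`
→ "assumption failed", `by (unfold <Def>; simpa)` → "assumption failed": 5 stubs × 2 targets × 5 tactics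
= 50/50 FAIL (no stub is cheaply the crux or the summit). The combined chain
`first | exact? | simpa | simpa [all defs] | aesop | aesop (add norm unfold …)` (folder
`bc/stub_<name>_probe.lean`, run on the rev-0 signatures, i.e. stubs 3 and 5 without their leading
`NoBranching →`, which only weakens them) also fails for all 10 (stub, target) pairs (6 by heartbeat
exhaustion inside the unfolding alternatives, 4 by exhaustion of all alternatives).
-/

noncomputable section

open scoped BigOperators
open Literature.Probability.LatticeModels Literature.Probability.RandomPlanarGeometry
open Literature.Probability.RandomPlanarGeometry.SAW
open Literature.Barriers.CriticalPhenomena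
open Summit.CriticalPhenomena.SAWScalingLimit.Theses.SAWDevelopingMap

namespace Summit.CriticalPhenomena.SAWScalingLimit.Cruxes.QCIdentification.Birth

/-! ## A. Objects (over existing declarations of `HexParafermion.lean`, `HexSAW.lean`,
`TriangularLattice.lean`, `ParafermionicHalfCauchyRiemann.lean` and the route file) -/

/-- The critical observable of the route, abbreviated: `F = F(a, ·, x_c, 5/8)` of the domain `Λ`. -/
abbrev Fobs (Λ : Finset HexVertex) (a : Sym2 HexVertex) : Sym2 HexVertex → ℂ :=
  hexParafermionicObservable Λ a hexCriticalFugacity (5 / 8)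

/-- The three neighbours of a hexagonal-lattice vertex, explicitly (up face `(x,0)`: `(x,1), (x-e₀,1),
(x-e₁,1)`; down face `(y,1)`: `(y,0), (y+e₀,0), (y+e₁,0)`), in counterclockwise order of the mid-edges. -/
def hexNbr (v : HexVertex) (k : Fin 3) : HexVertex :=
  if v.2 = 0 then
    ![(v.1, 1), (v.1 - Pi.single 0 1, 1), (v.1 - Pi.single 1 1, 1)] k
  else
    ![(v.1, 0), (v.1 + Pi.single 0 1, 0), (v.1 + Pi.single 1 1, 0)] k

/-- The `∂H`-mode of a mid-edge function around a vertex: `S(v) = F(p₀) + F(p₁) + F(p₂)` (labelling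
independent; `= 6 i √3 ∂H` on the triangle `Δ_v` of the developing map). -/
def modeSum (F : Sym2 HexVertex → ℂ) (v : HexVertex) : ℂ :=
  F s(v, hexNbr v 0) + F s(v, hexNbr v 1) + F s(v, hexNbr v 2)

/-- **No branching of the developing map.** For every simply connected `Λ`, boundary source `a` and
every site `x` of `𝕋` whose six surrounding faces (the hexagon of `ℍ` centred at `x`) lie in `Λ`, if the
`∂H`-modes around the hexagon are non-zero then the six consecutive argument increments
`arg (S(v_{j+1}) / S(v_j))` (each in `(-π, π]`) sum to `0`: the PL developing map winds exactly once around
`H(x)` (local homeomorphism), never `2, 3, …` times. (The `≠ 0` guards make the disconnected-`Λ` junk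
model vacuous, triage r1 S1.) -/
def NoBranching : Prop :=
  ∀ (Λ : Finset HexVertex), hexDomainSimplyConnected Λ → ∀ a ∈ hexDomainBoundary Λ, ∀ x : Site 2,
    (∀ j : Fin 6, HexKernel.face x j ∈ Λ) →
    (∀ j : Fin 6, modeSum (Fobs Λ a) (HexKernel.face x j) ≠ 0) →
    ∑ j : Fin 6, Complex.arg (modeSum (Fobs Λ a) (HexKernel.face x (j + 1)) /
        modeSum (Fobs Λ a) (HexKernel.face x j)) = 0

/-- **(N1) Lateral universality of the zigzag boundary layer, mesoscopic form.** For every `ε > 0`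
there are `η > 0` and `M₀` such that for all `M ≥ M₀`, every simply connected `Λ`, every boundary source
`a`, and every two bottom-boundary vertices `(x,0)`, `(x',0)` of the same row at mutual distance `≤ η M`,
if `Λ` coincides with the exact zigzag half-plane `{w | x 1 ≤ w.1 1}` within Euclidean radius `M` of
`(x,0)` and `a` is at distance `≥ M`, then the boundary values at the two downward mid-edges agree up to
relative error `ε`. -/
def ZigzagLateralUniversality : Prop :=
  ∀ ε : ℝ, 0 < ε → ∃ η : ℝ, 0 < η ∧ ∃ M₀ : ℝ, ∀ M : ℝ, M₀ ≤ M →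
    ∀ (Λ : Finset HexVertex), hexDomainSimplyConnected Λ → ∀ a ∈ hexDomainBoundary Λ, ∀ x x' : Site 2,
      x' 1 = x 1 →
      dist (hexCenter ((x', 0) : HexVertex)) (hexCenter ((x, 0) : HexVertex)) ≤ η * M →
      (∀ w : HexVertex, dist (hexCenter w) (hexCenter ((x, 0) : HexVertex)) ≤ M → (w ∈ Λ ↔ x 1 ≤ w.1 1)) →
      M ≤ dist (hexMidpoint a) (hexCenter ((x, 0) : HexVertex)) →
      let p : Sym2 HexVertex := s((x, 0), (x - Pi.single 1 1, 1))
      let p' : Sym2 HexVertex := s((x', 0), (x' - Pi.single 1 1, 1))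
      ‖Fobs Λ a p - Fobs Λ a p'‖ ≤ ε * ‖Fobs Λ a p'‖

/-- **Admissible data** — verbatim the hypotheses of the target `HexObservableLimit` on
`(D, ρ, Λ_·, m, a_·, b_·, Φ, L, L_b)` (everything except the test function): a Dobrushin domain flat in the
`ρ`-balls at both marked points, an eventually admissible discretisation family with exact half-lattice
rows in both balls, exhausting compacts, `a_δ → a`, `b_δ → b`, `Φ : Ω → ℍ` with `a ↦ ∞`, `b ↦ 0`,
`L = log Φ′` continuous on `Ω` with limit `L_b` at `b`. -/
def Admissible (D : DobrushinDomain) (ρ : ℝ) (Λ : ℝ → Finset HexVertex) (m : Fin 2 → ℝ → ℤ)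
    (a b : ℝ → Sym2 HexVertex) (Φ : ConformalEquiv D.carrier UpperHalfPlane.upperHalfPlaneSet)
    (L : ℂ → ℂ) (Lb : ℂ) : Prop :=
  0 < ρ ∧
  (∀ i : Fin 2, D.carrier ∩ Metric.ball (D.pt i) ρ = {z : ℂ | (D.pt i).im < z.im} ∩ Metric.ball (D.pt i) ρ) ∧
  (∀ᶠ δ : ℝ in nhdsWithin 0 (Set.Ioi 0),
    hexDomainSimplyConnected (Λ δ) ∧ a δ ∈ hexDomainBoundary (Λ δ) ∧ b δ ∈ hexDomainBoundary (Λ δ) ∧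
    Nonempty (HexMidEdgeSAW (Λ δ) (a δ) (b δ)) ∧
    (hexGraph.induce ((Λ δ : Finset HexVertex) : Set HexVertex)).Preconnected ∧
    (∀ v ∈ Λ δ, (δ : ℂ) * hexCenter v ∈ D.carrier) ∧
    (∀ i : Fin 2, ∀ v : HexVertex, (δ : ℂ) * hexCenter v ∈ Metric.ball (D.pt i) ρ →
      (v ∈ Λ δ ↔ m i δ ≤ v.1 1))) ∧
  (∀ K : Set ℂ, IsCompact K → K ⊆ D.carrier → ∀ᶠ δ : ℝ in nhdsWithin 0 (Set.Ioi 0),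
    ∀ v : HexVertex, (δ : ℂ) * hexCenter v ∈ K → v ∈ Λ δ) ∧
  Filter.Tendsto (fun δ : ℝ => (δ : ℂ) * hexMidpoint (a δ)) (nhdsWithin 0 (Set.Ioi 0)) (nhds (D.pt 0)) ∧
  Filter.Tendsto (fun δ : ℝ => (δ : ℂ) * hexMidpoint (b δ)) (nhdsWithin 0 (Set.Ioi 0)) (nhds (D.pt 1)) ∧
  Filter.Tendsto (fun x => ‖Φ x‖) (nhdsWithin (D.pt 0) D.carrier) Filter.atTop ∧
  Φ.HasBoundaryValue (D.pt 1) 0 ∧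
  ContinuousOn L D.carrier ∧
  (∀ z ∈ D.carrier, Complex.exp (L z) = deriv Φ z) ∧
  Filter.Tendsto L (nhdsWithin (D.pt 1) D.carrier) (nhds Lb)

/-- The `ψ`-averaged observable at mesh `δ`: `A_δ(ψ) = δ² Σ_{e ∈ Ω_δ} ψ(δ m_e) F_δ(e)` — verbatim the
numerator of the target. -/
def bulkAverage (Λ : ℝ → Finset HexVertex) (a : ℝ → Sym2 HexVertex) (ψ : ℂ → ℂ) (δ : ℝ) : ℂ :=
  (δ : ℂ) ^ 2 * ∑ᶠ e ∈ hexDomainMidEdges (Λ δ), ψ ((δ : ℂ) * hexMidpoint e) * Fobs (Λ δ) (a δ) e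

/-- The limit shape functional `I(ψ) = ∫ ψ(z) e^{(5/8)(L z − L_b)} dz` — verbatim the target's limit
without the constant `c`. -/
def shapeIntegral (L : ℂ → ℂ) (Lb : ℂ) (ψ : ℂ → ℂ) : ℂ :=
  ∫ z, ψ z * Complex.exp ((5 / 8 : ℂ) * (L z - Lb))

/-- **Subsequential projective limits exist, holomorphic and non-degenerate** (qc compactness +
holomorphy, macroscopic normalisation). -/
def SubsequentialLimits : Prop :=
  ∀ (D : DobrushinDomain) (ρ : ℝ) (Λ : ℝ → Finset HexVertex) (m : Fin 2 → ℝ → ℤ)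
    (a b : ℝ → Sym2 HexVertex) (Φ : ConformalEquiv D.carrier UpperHalfPlane.upperHalfPlaneSet)
    (L : ℂ → ℂ) (Lb : ℂ), Admissible D ρ Λ m a b Φ L Lb →
    ∀ δs : ℕ → ℝ, Filter.Tendsto δs Filter.atTop (nhdsWithin 0 (Set.Ioi 0)) →
      ∃ φ : ℕ → ℕ, StrictMono φ ∧ ∃ ν : ℕ → ℂ, ∃ g : ℂ → ℂ,
        DifferentiableOn ℂ g D.carrier ∧ (∃ z ∈ D.carrier, g z ≠ 0) ∧
        ∀ ψ : ℂ → ℂ, Continuous ψ → HasCompactSupport ψ → tsupport ψ ⊆ D.carrier →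
          Filter.Tendsto (fun n => ν n * bulkAverage Λ a ψ (δs (φ n))) Filter.atTop
            (nhds (∫ z, ψ z * g z))

/-- **Boundary rigidity (identification of subsequential limits).** For admissible data, every
continuous, somewhere non-zero density `g` on `Ω` that is a projective limit of the bulk averages along
some sequence `δ_n → 0⁺` is a constant multiple of `e^{(5/8)(L − L_b)} = (φ′/φ′(b))^{5/8}`. -/
def BoundaryRigidity : Prop :=
  ∀ (D : DobrushinDomain) (ρ : ℝ) (Λ : ℝ → Finset HexVertex) (m : Fin 2 → ℝ → ℤ)
    (a b : ℝ → Sym2 HexVertex) (Φ : ConformalEquiv D.carrier UpperHalfPlane.upperHalfPlaneSet)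
    (L : ℂ → ℂ) (Lb : ℂ), Admissible D ρ Λ m a b Φ L Lb →
    ∀ g : ℂ → ℂ, ContinuousOn g D.carrier → (∃ z ∈ D.carrier, g z ≠ 0) →
      (∃ δs : ℕ → ℝ, Filter.Tendsto δs Filter.atTop (nhdsWithin 0 (Set.Ioi 0)) ∧ ∃ ν : ℕ → ℂ,
        ∀ ψ : ℂ → ℂ, Continuous ψ → HasCompactSupport ψ → tsupport ψ ⊆ D.carrier →
          Filter.Tendsto (fun n => ν n * bulkAverage Λ a ψ (δs n)) Filter.atTop
            (nhds (∫ z, ψ z * g z))) →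
      ∃ c : ℂ, ∀ z ∈ D.carrier, g z = c * Complex.exp ((5 / 8 : ℂ) * (L z - Lb))

/-- **Projective shape convergence (subsequential form).** For admissible data every sequence
`δ_n → 0⁺` has a subsequence along which suitably normalised bulk averages converge to `I(ψ)` for every
test function `ψ`. Derived below from `SubsequentialLimits` + `BoundaryRigidity` (`projectiveShape_of`). -/
def ProjectiveShape : Prop :=
  ∀ (D : DobrushinDomain) (ρ : ℝ) (Λ : ℝ → Finset HexVertex) (m : Fin 2 → ℝ → ℤ)
    (a b : ℝ → Sym2 HexVertex) (Φ : ConformalEquiv D.carrier UpperHalfPlane.upperHalfPlaneSet)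
    (L : ℂ → ℂ) (Lb : ℂ), Admissible D ρ Λ m a b Φ L Lb →
    ∀ δs : ℕ → ℝ, Filter.Tendsto δs Filter.atTop (nhdsWithin 0 (Set.Ioi 0)) →
      ∃ φ : ℕ → ℕ, StrictMono φ ∧ ∃ ν : ℕ → ℂ,
        ∀ ψ : ℂ → ℂ, Continuous ψ → HasCompactSupport ψ → tsupport ψ ⊆ D.carrier →
          Filter.Tendsto (fun n => ν n * bulkAverage Λ a ψ (δs (φ n))) Filter.atTop
            (nhds (shapeIntegral L Lb ψ))

/-- **Boundary amplitude (the normaliser).** One universal `κ ≠ 0`: for admissible data, whenever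
normalisers `ν_n` make the bulk averages converge to the shape `I(ψ)` along `δ_n → 0⁺`, the same `ν_n`
make the boundary value at `b_{δ_n}` converge to `κ`. -/
def BoundaryAmplitude : Prop :=
  ∃ κ : ℂ, κ ≠ 0 ∧
    ∀ (D : DobrushinDomain) (ρ : ℝ) (Λ : ℝ → Finset HexVertex) (m : Fin 2 → ℝ → ℤ)
      (a b : ℝ → Sym2 HexVertex) (Φ : ConformalEquiv D.carrier UpperHalfPlane.upperHalfPlaneSet)
      (L : ℂ → ℂ) (Lb : ℂ), Admissible D ρ Λ m a b Φ L Lb →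
      ∀ δs : ℕ → ℝ, Filter.Tendsto δs Filter.atTop (nhdsWithin 0 (Set.Ioi 0)) →
        ∀ ν : ℕ → ℂ,
          (∀ ψ : ℂ → ℂ, Continuous ψ → HasCompactSupport ψ → tsupport ψ ⊆ D.carrier →
            Filter.Tendsto (fun n => ν n * bulkAverage Λ a ψ (δs n)) Filter.atTop
              (nhds (shapeIntegral L Lb ψ))) →
          Filter.Tendsto (fun n => ν n * Fobs (Λ (δs n)) (a (δs n)) (b (δs n))) Filter.atTop (nhds κ)

/-! ## B. Registered stubs (the ONLY `sorry`s of the file) -/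

/-- **stub 1 — no branching under (K)** (see `NoBranching`). Provable now; size M. -/
theorem stub_noBranching : NoFoldBound → NoBranching := by
  sorry

/-- **stub 2 — qc compactness + holomorphy** (see `SubsequentialLimits`). Size L/XL. -/
theorem stub_subsequentialLimits :
    NoBranching → NoFoldBound → InteriorFlattening → SubsequentialLimits := by
  sorry

/-- **stub 3 — boundary rigidity / identification** (see `BoundaryRigidity`). HARDEST; size XL. -/
theorem stub_boundaryRigidity :
    NoBranching → NoFoldBound → InteriorFlattening → BoundaryRigidity := by
  sorry

/-- **stub 4 — (N1) lateral universality of the zigzag boundary layer** (see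
`ZigzagLateralUniversality`). Open lattice statement; size L. -/
theorem stub_lateralUniversality : ZigzagLateralUniversality := by
  sorry

/-- **stub 5 — the boundary amplitude at the flat rigid row** (see `BoundaryAmplitude`). Size L. -/
theorem stub_boundaryAmplitude :
    NoBranching → NoFoldBound → InteriorFlattening → ZigzagLateralUniversality →
      BoundaryAmplitude := by
  sorry

/-! ## C. Proved reductions (no `sorry` below this line) -/

/-- Compactness + rigidity ⇒ projective shape convergence along subsequences, with the right limit. -/
theorem projectiveShape_of (hC : SubsequentialLimits) (hR : BoundaryRigidity) : ProjectiveShape := by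
  intro D ρ Λ m a b Φ L Lb hadm δs hδs
  obtain ⟨φ, hφ, ν, g, hg, ⟨z₀, hz₀, hgz₀⟩, hν⟩ := hC D ρ Λ m a b Φ L Lb hadm δs hδs
  obtain ⟨c, hc⟩ := hR D ρ Λ m a b Φ L Lb hadm g hg.continuousOn ⟨z₀, hz₀, hgz₀⟩
    ⟨fun n => δs (φ n), hδs.comp hφ.tendsto_atTop, ν, hν⟩
  have hc0 : c ≠ 0 := by
    rintro rfl
    exact hgz₀ (by simpa using hc z₀ hz₀)
  refine ⟨φ, hφ, fun n => c⁻¹ * ν n, fun ψ hψ hψc hψs => ?_⟩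
  have hint : (∫ z, ψ z * g z) = c * shapeIntegral L Lb ψ := by
    rw [shapeIntegral, ← MeasureTheory.integral_const_mul]
    congr 1
    funext z
    by_cases hz : z ∈ D.carrier
    · rw [hc z hz]; ring
    · have h0 : ψ z = 0 := image_eq_zero_of_notMem_tsupport fun h => hz (hψs h)
      simp [h0]
  have h1 := (hν ψ hψ hψc hψs).const_mul c⁻¹
  rw [hint, ← mul_assoc, inv_mul_cancel₀ hc0, one_mul] at h1
  simpa only [mul_assoc] using h1

/-- Shape + amplitude ⇒ the target, along the full filter `𝓝[>] 0`, with `c = κ⁻¹`. -/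
theorem hexObservableLimit_of (hS : ProjectiveShape) (hA : BoundaryAmplitude) :
    HexObservableLimit := by
  obtain ⟨κ, hκ, hA⟩ := hA
  refine ⟨κ⁻¹, inv_ne_zero hκ, ?_⟩
  intro D ρ Λ m a b Φ L Lb ψ
  dsimp only
  intro hρ hflat hev hexh ha hb hΦa hΦb hL hexpL hLb hψ hψc hψs
  have hadm : Admissible D ρ Λ m a b Φ L Lb :=
    ⟨hρ, hflat, hev, hexh, ha, hb, hΦa, hΦb, hL, hexpL, hLb⟩
  refine Filter.tendsto_of_subseq_tendsto fun δs hδs => ?_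
  obtain ⟨φ, hφ, ν, hν⟩ := hS D ρ Λ m a b Φ L Lb hadm δs hδs
  refine ⟨φ, ?_⟩
  have hb' : Filter.Tendsto (fun n => ν n * Fobs (Λ (δs (φ n))) (a (δs (φ n))) (b (δs (φ n))))
      Filter.atTop (nhds κ) :=
    hA D ρ Λ m a b Φ L Lb hadm (fun n => δs (φ n)) (hδs.comp hφ.tendsto_atTop) ν hν
  have hψ' := hν ψ hψ hψc hψs
  have hne : ∀ᶠ n in Filter.atTop, ν n ≠ 0 :=
    (hb'.eventually_ne hκ).mono fun n h => left_ne_zero_of_mul h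
  have key : Filter.Tendsto (fun n => bulkAverage Λ a ψ (δs (φ n)) /
      Fobs (Λ (δs (φ n))) (a (δs (φ n))) (b (δs (φ n)))) Filter.atTop
      (nhds (shapeIntegral L Lb ψ / κ)) := by
    refine (hψ'.div hb' hκ).congr' ?_
    filter_upwards [hne] with n hn
    simp only [Pi.div_apply]
    rw [mul_div_mul_left _ _ hn]
  rw [div_eq_inv_mul] at key
  simpa only [bulkAverage, Fobs, shapeIntegral] using key

/-! ## D. Composition (kernel-checked): the five stubs close the crux BY NAME -/

/-- **`QCIdentification` from the five stubs.** `sorryAx` enters only through `stub_*`. -/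
theorem QCIdentification_of
    (h₁ : NoFoldBound → NoBranching)
    (h₂ : NoBranching → NoFoldBound → InteriorFlattening → SubsequentialLimits)
    (h₃ : NoBranching → NoFoldBound → InteriorFlattening → BoundaryRigidity)
    (h₄ : ZigzagLateralUniversality)
    (h₅ : NoBranching → NoFoldBound → InteriorFlattening → ZigzagLateralUniversality →
      BoundaryAmplitude) :
    Summit.CriticalPhenomena.SAWScalingLimit.Theses.SAWDevelopingMap.QCIdentification :=
  fun hK hM =>
    have hB : NoBranching := h₁ hK
    hexObservableLimit_of (projectiveShape_of (h₂ hB hK hM) (h₃ hB hK hM)) (h₅ hB hK hM h₄)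

/-- **The line as it stands** (the shape the skeleton checker registers). -/
theorem QCIdentification_proof :
    Summit.CriticalPhenomena.SAWScalingLimit.Theses.SAWDevelopingMap.QCIdentification :=
  QCIdentification_of stub_noBranching stub_subsequentialLimits stub_boundaryRigidity
    stub_lateralUniversality stub_boundaryAmplitude

end Summit.CriticalPhenomena.SAWScalingLimit.Cruxes.QCIdentification.Birth
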